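import Literature.NumberTheory.EllipticCurves.CastellaWan2024.SupersingularPConverse
import Literature.NumberTheory.EllipticCurves.BSDRankResidualCellsProofs
import HarnessLib

/-!
# Castella–Wan, Math. Ann. 389 (2024), Theorem A in the `(rank, Ш[p^∞])` currency of the tree's
# `p`-converse table — PROVED relative to Theorem A (theorems only)

Sibling proof file (theorems only; no definition, no named fact — D-0014/D-0026) of
`Literature.NumberTheory.EllipticCurves.CastellaWan2024.SupersingularPConverse` (named fact
`thmA_analyticRank_eq_one_of_selmerCorank_eq_one` = Castella–Wan, Math. Ann. 389 (2024), Thm. A: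
for a semistable `E/ℚ` and a good supersingular `p > 3`, `corank_{ℤ_p} Sel_{p^∞}(E/ℚ) = 1 ⟹
ord_{s=1} L(E,s) = 1`). HONEST FRAMING (cell `b2b-bsdres`, off-peak literature typer
`b2b-bsdres-lit-cw`): research routes, no claim beyond stated classes; a `p`-CONVERSE, not `BSD_p`;
X6 stays construction-shaped; nothing is asserted — Theorem A and Gross–Zagier–Kolyvagin enter as
explicit binders.

WHY THIS FILE. The tree's table of rank-one `p`-converse theorems (`BSDSelmer.lean` §bsd.S25) is kept
in TWO currencies: the Selmer-corank currency `corank_{ℤ_p} Sel_{p^∞}(E/ℚ) = 1 ⟹ ord = 1`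
(Burungale–Skinner–Tian–Wan Thm. 1.10, `burungaleSkinnerTianWan_analyticRank_eq_one_of_selmerCorank_eq_one`;
Castella–Wan Thm. A, the sibling's named fact) and the Mordell–Weil currency
`rank_ℤ E(ℚ) = 1 ∧ #Ш(E/ℚ) < ∞ ⟹ ord = 1` (Skinner, Ann. of Math. 191 (2020) Thm. A′,
`skinner_analyticRank_eq_one_of_mordellWeilRank_eq_one`; C.-H. Kim, Math. Ann. 387 (2022) Cor. 1.4,
`kim_analyticRank_eq_one_of_mordellWeilRank_eq_one` — all ORDINARY or multiplicative). The second
currency is the WEAKER one: by the corank identity `corank Sel_{p^∞} = rank + corank Ш[p^∞]`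
(Greenberg, LNM 1716 (1999) §1; tree THEOREM `WeierstrassCurve.selmerCorank_eq_mordellWeilRank_add_holds`,
packaged as `selmerCorank_eq_mordellWeilRank_of_finite_shaPrimary`), `rank = 1 ∧ Ш[p^∞] finite`
gives corank `1`. Castella–Wan state Theorem A in the STRONGER currency on purpose (MS p. 2: "our
method does not require the hypothesis that `#Ш(E/ℚ)[p^∞] < ∞`"); this file merely records the
supersingular column of the table in the Mordell–Weil currency too, so that consumers written against
Skinner's Thm. A′ shape (`rank = 1`, `Finite Ш`) can take the supersingular semistable case from a
PUBLISHED theorem by name, and proves the resulting equivalence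
`rank = 1 ∧ #Ш < ∞ ⟺ ord_{s=1} L(E,s) = 1` on class X6 at `p ≥ 5` (⇐ is Gross–Zagier–Kolyvagin).

Transcription as in the sibling (module docstring there): `W` globally minimal; `Semistable W`;
`GoodSS W p` (good at `p`, `p ∣ a_p`; = `a_p = 0` for `p > 3`); `W.mordellWeilRank`, `W.analyticRank`,
`W.sha`; `Ш(E/ℚ)[p^∞]` = `AddCommGroup.primaryComponent W.sha p` (the tree's reading in
`BSDRankResidualCellsProofs`, `IwasawaLeadingTermProofs.finite_primaryComponent_sha_iff_shaCorank_eq_zero`).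

## References
* [CastellaWan2023] F. Castella, X. Wan, Math. Ann. 389 (2024) 2595–2636, Thm. A (p. 2596; authors'
  MS `paper:url-7157bd4f7b88` p. 2), and §1.1 (1.1) (the descent sequence).
* [Greenberg1999LNM] R. Greenberg, LNM 1716 (1999) §1, pp. 54–57 (corank identity).
* [Skinner2020] C. Skinner, Ann. of Math. 191 (2020), Thm. A′ (the Mordell–Weil currency).
* [Darmon2004] H. Darmon, CBMS 101 (2004), Thm. 3.22 (Gross–Zagier–Kolyvagin, binder `hGZK`).
-/

set_option autoImplicit false

noncomputable section

open scoped Classical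

open WeierstrassCurve Literature.NumberTheory.EllipticCurves
  Literature.NumberTheory.EllipticCurves.Rank1Residual

namespace Literature.NumberTheory.EllipticCurves.CastellaWan2024

/-- **Theorem A in the `(rank, Ш[p^∞])` currency.** Granted Castella–Wan Thm. A (`h`): for a
semistable `E/ℚ` and a prime `p > 3` of good supersingular reduction,
`rank_ℤ E(ℚ) = 1 ∧ #Ш(E/ℚ)[p^∞] < ∞ ⟹ ord_{s=1} L(E,s) = 1` — since then
`corank_{ℤ_p} Sel_{p^∞}(E/ℚ) = rank + corank Ш[p^∞] = 1` (Greenberg's corank identity, tree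
theorem `selmerCorank_eq_mordellWeilRank_of_finite_shaPrimary`). WEAKER than Thm. A as printed
(MS p. 2: "our method does not require the hypothesis that `#Ш(E/ℚ)[p^∞] < ∞`").
[cite: CastellaWan2023, Thm. A (p. 2596) and (1.1); authors' MS pp. 1–2]
[cite: Greenberg1999LNM, §1 pp. 54–57] -/
theorem analyticRank_eq_one_of_mordellWeilRank_eq_one_of_finite_shaPrimary
    (h : thmA_analyticRank_eq_one_of_selmerCorank_eq_one) (W : WeierstrassCurve ℚ) [W.IsElliptic]
    [W.IsGloballyMinimal] (p : ℕ) [Fact p.Prime] (hp : 3 < p) (hss : Semistable W)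
    (hred : GoodSS W p) (hrank : W.mordellWeilRank = 1)
    (hsha : Finite (AddCommGroup.primaryComponent W.sha p)) : W.analyticRank = 1 :=
  h W p hp hss hred ((selmerCorank_eq_mordellWeilRank_of_finite_shaPrimary W p hsha).trans hrank)

/-- **Theorem A in Skinner's Thm. A′ currency** (`rank_ℤ E(ℚ) = 1` and the FULL `Ш(E/ℚ)` finite):
a semistable `E/ℚ` with a good supersingular `p > 3`, `rank_ℤ E(ℚ) = 1` and `#Ш(E/ℚ) < ∞` has
`ord_{s=1} L(E,s) = 1`, granted Thm. A (`h`). (`Ш` finite ⇒ `Ш[p^∞]` finite ⇒ the previous theorem.)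
[cite: CastellaWan2023, Thm. A (p. 2596); authors' MS p. 2] [cite: Skinner2020, Thm. A′ (the shape)] -/
theorem analyticRank_eq_one_of_mordellWeilRank_eq_one_of_finite_sha
    (h : thmA_analyticRank_eq_one_of_selmerCorank_eq_one) (W : WeierstrassCurve ℚ) [W.IsElliptic]
    [W.IsGloballyMinimal] (p : ℕ) [Fact p.Prime] (hp : 3 < p) (hss : Semistable W)
    (hred : GoodSS W p) (hrank : W.mordellWeilRank = 1) (hsha : Finite W.sha) :
    W.analyticRank = 1 :=
  haveI := hsha
  analyticRank_eq_one_of_mordellWeilRank_eq_one_of_finite_shaPrimary h W p hp hss hred hrank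
    inferInstance

/-- **`rank_ℤ E(ℚ) = 1 ∧ #Ш(E/ℚ) < ∞ ⟺ ord_{s=1} L(E,s) = 1`** for a semistable `E` at a good
supersingular `p > 3`: `⇒` is Thm. A in the Mordell–Weil currency (`h`), `⇐` is
Gross–Zagier–Kolyvagin (`hGZK`, Darmon 2004 Thm. 3.22: `ord ≤ 1 ⇒ rank = ord ∧ #Ш < ∞`).
[cite: CastellaWan2023, Thm. A and §1.1 (pp. 2595–2596); authors' MS pp. 1–2]
[cite: Darmon2004, Thm. 3.22] -/
theorem mordellWeilRank_eq_one_and_finite_sha_iff_analyticRank_eq_one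
    (h : thmA_analyticRank_eq_one_of_selmerCorank_eq_one)
    (hGZK : rank_eq_analyticRank_of_analyticRank_le_one) (W : WeierstrassCurve ℚ) [W.IsElliptic]
    [W.IsGloballyMinimal] (p : ℕ) [Fact p.Prime] (hp : 3 < p) (hss : Semistable W)
    (hred : GoodSS W p) : (W.mordellWeilRank = 1 ∧ Finite W.sha) ↔ W.analyticRank = 1 := by
  refine ⟨fun hr ↦ analyticRank_eq_one_of_mordellWeilRank_eq_one_of_finite_sha h W p hp hss hred
    hr.1 hr.2, fun hr ↦ ?_⟩
  obtain ⟨hrank, hsha⟩ := hGZK W hr.le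
  exact ⟨hrank.trans hr, hsha⟩

/-! ### On the cell's class X6 (supersingular, semistable) at `p ≥ 5` -/

section ClassX6

/-- **X6 ∩ {p ≥ 5}, Mordell–Weil currency:** `rank_ℤ E(ℚ) = 1 ∧ #Ш(E/ℚ)[p^∞] < ∞ ⟹
ord_{s=1} L(E,s) = 1`, granted Thm. A (`h`). NOT `BSD_p`; X6 stays construction-shaped.
[cite: CastellaWan2023, Thm. A (p. 2596); authors' MS p. 2] -/
theorem X6.analyticRank_eq_one_of_mordellWeilRank_eq_one_of_finite_shaPrimary
    (h : thmA_analyticRank_eq_one_of_selmerCorank_eq_one) (W : WeierstrassCurve ℚ) [W.IsElliptic]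
    [W.IsGloballyMinimal] (p : ℕ) [Fact p.Prime] (hp : 5 ≤ p) (hX : ClassX6 W p)
    (hrank : W.mordellWeilRank = 1) (hsha : Finite (AddCommGroup.primaryComponent W.sha p)) :
    W.analyticRank = 1 :=
  CastellaWan2024.analyticRank_eq_one_of_mordellWeilRank_eq_one_of_finite_shaPrimary h W p
    (by omega) hX.2.1 hX.1 hrank hsha

/-- **X6 ∩ {p ≥ 5}, Skinner Thm. A′ shape:** `rank_ℤ E(ℚ) = 1 ∧ #Ш(E/ℚ) < ∞ ⟹ ord_{s=1} L(E,s) = 1`,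
granted Thm. A (`h`). [cite: CastellaWan2023, Thm. A (p. 2596); authors' MS p. 2] -/
theorem X6.analyticRank_eq_one_of_mordellWeilRank_eq_one_of_finite_sha
    (h : thmA_analyticRank_eq_one_of_selmerCorank_eq_one) (W : WeierstrassCurve ℚ) [W.IsElliptic]
    [W.IsGloballyMinimal] (p : ℕ) [Fact p.Prime] (hp : 5 ≤ p) (hX : ClassX6 W p)
    (hrank : W.mordellWeilRank = 1) (hsha : Finite W.sha) : W.analyticRank = 1 :=
  CastellaWan2024.analyticRank_eq_one_of_mordellWeilRank_eq_one_of_finite_sha h W p (by omega)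
    hX.2.1 hX.1 hrank hsha

/-- **X6 ∩ {p ≥ 5}: `rank = 1 ∧ #Ш < ∞ ⟺ ord = 1`** (Thm. A one way, Gross–Zagier–Kolyvagin the
other). [cite: CastellaWan2023, Thm. A and §1.1 (pp. 2595–2596); authors' MS pp. 1–2]
[cite: Darmon2004, Thm. 3.22] -/
theorem X6.mordellWeilRank_eq_one_and_finite_sha_iff_analyticRank_eq_one
    (h : thmA_analyticRank_eq_one_of_selmerCorank_eq_one)
    (hGZK : rank_eq_analyticRank_of_analyticRank_le_one) (W : WeierstrassCurve ℚ) [W.IsElliptic]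
    [W.IsGloballyMinimal] (p : ℕ) [Fact p.Prime] (hp : 5 ≤ p) (hX : ClassX6 W p) :
    (W.mordellWeilRank = 1 ∧ Finite W.sha) ↔ W.analyticRank = 1 :=
  CastellaWan2024.mordellWeilRank_eq_one_and_finite_sha_iff_analyticRank_eq_one h hGZK W p
    (by omega) hX.2.1 hX.1

end ClassX6

end Literature.NumberTheory.EllipticCurves.CastellaWan2024

end
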